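import Literature.Computability.Cryptography.GraphPathProblems
import HarnessLib

/-!
# Weighted graph path problems — discharged facts

Proofs of named facts stated in `Literature.Computability.Cryptography.GraphPathProblems` (kept in a
sibling file so that the statement file stays a definitions/named-facts file; D-0014):

* `hasNegativeTriangle_iff_minPlus_holds` discharges `hasNegativeTriangle_iff_minPlus`: an
  integer-weighted complete digraph `W` has a negative triangle iff, with `W'` = `W` with `⊤` on the
  diagonal, some off-diagonal pair `i ≠ j` has `(W' ⋆ W') i j + W j i < 0` (one `(min,+)`-product).
  This is the combinatorial core of Vassilevska Williams–Williams, J. ACM 65 (2018), §4.1, proof of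
  Theorem 4.1 (Negative Triangle over `R̄` ≤₃ Matrix Product Verification over `R̄`, p. 27:14):
  "there must exist a `k ∈ [n]` so that `A[i,k] ⊙ B[k,j] < C[i,j]`. In other words, `i, k, j` is a
  negative triangle … if for all `i, j` we have `minₖ (A[i,k] ⊙ B[k,j]) ≥ C[i,j]`, there is no
  negative triangle" (with `C[i,j] = -w(i,j)`), specialised to the `(min,+)` structure on `ℤ`, where
  "the tripartiteness requirement is unnecessary" (loc. cit. §2, p. 27:7); the `⊤` diagonal forces the
  middle vertex to differ from both endpoints.
* Unit-weight bridge (`zeroOneWeights`; the identification of an unweighted graph with the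
  `{1, ∞}`-weighted digraph implicit in loc. cit. §1 / Theorem 1.1, weights in
  `{-M, …, M} ∪ {-∞, ∞}` with `M = 1`), relating the tropical-matrix-power notions `walkDistLE`,
  `shortestDist`, `weightedEccentricity` to Mathlib's `SimpleGraph.edist`, `SimpleGraph.eccent`:
  - `walkDistLE_succ_apply_holds : walkDistLE_succ_apply` and `walkDistLE_succ_apply_left` — the
    CLRS recurrence (25.2) `L⁽ᵏ⁺¹⁾ᵢⱼ = min (L⁽ᵏ⁾ᵢⱼ, minₗ L⁽ᵏ⁾ᵢₗ + wₗⱼ)` and its mirror image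
    (first edge instead of last edge), read off
    `(1 + A)^(k+1) = (1 + A)^k (1 + A) = (1 + A) (1 + A)^k` in the tropical matrix semiring;
  - `walkDistLE_antitone_holds : walkDistLE_antitone`, `shortestDist_le_of_le_holds :
    shortestDist_le_of_le` — immediate from the recurrence;
  - `walkDistLE_zeroOneWeights_le_length`, `walkDistLE_zeroOneWeights_eq_top_or_exists_walk` — for
    unit weights, `walkDistLE (zeroOneWeights G) k i j` is at most the length of any walk `i → j`
    with at most `k` edges, and is either `⊤` or the length of such a walk (induction on the walk,
    resp. on `k`, via the first-edge recurrence);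
  - `shortestDist_zeroOneWeights_holds : shortestDist_zeroOneWeights` — hence
    `shortestDist (zeroOneWeights G) i j = G.edist i j` (a shortest walk may be taken to be a path,
    which has `< card ι` edges, `SimpleGraph.Walk.IsPath.length_lt`);
  - `hasNoNegativeCycle_zeroOneWeights_holds : hasNoNegativeCycle_zeroOneWeights`
    (`edist i i = 0`);
  - `weightedEccentricity_zeroOneWeights_holds : weightedEccentricity_zeroOneWeights` — the finite
    supremum over `j` commutes with the monotone transport `ENat.map Nat.cast : ℕ∞ → WithTop ℤ`.

  Mathlib anchors: `Tropical.untrop_add`, `Finset.untrop_sum'`, `Matrix.mul_apply`,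
  `SimpleGraph.Reachable.exists_walk_length_eq_edist`, `SimpleGraph.edist_le`,
  `SimpleGraph.Walk.bypass_isPath`, `SimpleGraph.Walk.IsPath.length_lt`,
  `Finset.sup'_univ_eq_ciSup`, `Finset.apply_sup'_eq_sup'_comp`, `ENat.monotone_map_iff`.

## References

* V. Vassilevska Williams, R. R. Williams, *Subcubic equivalences between path, matrix, and triangle
  problems*, J. ACM 65 (2018), no. 5, Art. 27, §2 p. 27:7 and §4.1 p. 27:14. doi:10.1145/3186893
* V. Vassilevska Williams, R. R. Williams, loc. cit., §1 and Theorem 1.1 (p. 27:3: APSP,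
  Radius/Median, weights in `{-M, …, M} ∪ {-∞, ∞}`; unweighted graphs are the case `M = 1`).
* T. Cormen, C. Leiserson, R. Rivest, C. Stein, *Introduction to Algorithms*, 3rd ed. (2009),
  §25.1 (shortest paths and matrix multiplication; recurrence (25.2); `L⁽ᵐ⁾` = optimum over walks
  with at most `m` edges).
-/

namespace Literature.Computability.Cryptography

open Matrix Tropical

variable {ι : Type*} [Fintype ι] [DecidableEq ι]

/-- Discharges `hasNegativeTriangle_iff_minPlus` (Negative Triangle via one `(min,+)`-product):
`minₗ (W' i l + W' l j) + W j i < 0` iff some `l` gives `W' i l + W' l j + W j i < 0`; a summand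
`⊤` (i.e. `l = i` or `l = j`) is impossible, so `i, l, j` are pairwise distinct and form a negative
triangle, and conversely a negative triangle `(i, j, k)` bounds the minimum for the pair `(i, k)` by
its `j`-term. Source: Vassilevska Williams–Williams, J. ACM 65 (2018), §4.1, proof of Theorem 4.1.
[cite: VassilevskaWilliamsWilliams2018, §4.1 proof of Theorem 4.1 (p. 27:14); §2 p. 27:7] -/
theorem hasNegativeTriangle_iff_minPlus_holds : (hasNegativeTriangle_iff_minPlus (ι := ι)) := by
  intro W
  set W' : Matrix ι ι (WithTop ℤ) :=
    Matrix.of fun a b => if a = b then ⊤ else (W a b : WithTop ℤ) with hW'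
  have hW'ne : ∀ {a b : ι}, a ≠ b → W' a b = (W a b : WithTop ℤ) := fun h => by
    simp [hW', h]
  have hW'eq : ∀ a : ι, W' a a = ⊤ := fun a => by simp [hW']
  constructor
  · rintro ⟨i, j, k, hij, hjk, hik, hlt⟩
    refine ⟨i, k, hik, ?_⟩
    have h1 : minPlusProduct W' W' i k ≤ W' i j + W' j k := by
      rw [minPlusProduct_apply]
      exact Finset.inf_le (Finset.mem_univ j)
    have h2 : W' i j + W' j k = ((W i j + W j k : ℤ) : WithTop ℤ) := by
      rw [hW'ne hij, hW'ne hjk]; push_cast; rfl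
    calc minPlusProduct W' W' i k + (W k i : WithTop ℤ)
        ≤ ((W i j + W j k : ℤ) : WithTop ℤ) + (W k i : WithTop ℤ) :=
          add_le_add (h1.trans_eq h2) le_rfl
      _ = ((W i j + W j k + W k i : ℤ) : WithTop ℤ) := by push_cast; rfl
      _ < 0 := by exact_mod_cast hlt
  · rintro ⟨i, j, hij, hlt⟩
    rw [minPlusProduct_apply] at hlt
    obtain ⟨k, -, hk⟩ :=
      Finset.exists_mem_eq_inf Finset.univ ⟨i, Finset.mem_univ i⟩ fun k => W' i k + W' k j
    rw [hk] at hlt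
    by_cases hik : i = k
    · subst hik
      rw [hW'eq] at hlt
      simp at hlt
    by_cases hkj : k = j
    · subst hkj
      rw [hW'eq] at hlt
      simp at hlt
    refine ⟨i, k, j, hik, hkj, hij, ?_⟩
    rw [hW'ne hik, hW'ne hkj] at hlt
    exact_mod_cast hlt

/-! ### The Bellman–Ford recurrences for `walkDistLE` -/

/-- **Discharge of `walkDistLE_succ_apply`** (last-edge recurrence, CLRS (25.2)):
`walkDistLE W (k+1) i j = min (walkDistLE W k i j) (minₗ walkDistLE W k i l + W l j)`, from
`(1 + A)^(k+1) = (1 + A)^k + (1 + A)^k * A` in the tropical matrix semiring.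
[cite: CLRS2009, §25.1 recurrence (25.2)] -/
theorem walkDistLE_succ_apply_holds : walkDistLE_succ_apply (ι := ι) := by
  intro W k i j
  simp only [walkDistLE, Matrix.map_apply]
  rw [pow_succ, mul_add, mul_one, Matrix.add_apply, untrop_add, Matrix.mul_apply,
    Finset.untrop_sum']
  rfl

/-- First-edge form of the CLRS recurrence:
`walkDistLE W (k+1) i j = min (walkDistLE W k i j) (minₗ W i l + walkDistLE W k l j)`, from
`(1 + A)^(k+1) = (1 + A)^k + A * (1 + A)^k` in the tropical matrix semiring.
[cite: CLRS2009, §25.1 recurrence (25.2)] -/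
theorem walkDistLE_succ_apply_left (W : Matrix ι ι (WithTop ℤ)) (k : ℕ) (i j : ι) :
    walkDistLE W (k + 1) i j =
      min (walkDistLE W k i j) (Finset.univ.inf fun l => W i l + walkDistLE W k l j) := by
  simp only [walkDistLE, Matrix.map_apply]
  rw [pow_succ', add_mul, one_mul, Matrix.add_apply, untrop_add, Matrix.mul_apply,
    Finset.untrop_sum']
  rfl

/-- **Discharge of `walkDistLE_antitone`**: allowing more edges can only decrease the optimum,
`walkDistLE W (k+1) i j ≤ walkDistLE W k i j`. [cite: CLRS2009, §25.1] -/
theorem walkDistLE_antitone_holds : walkDistLE_antitone (ι := ι) := by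
  intro W i j
  refine antitone_nat_of_succ_le fun k => ?_
  rw [walkDistLE_succ_apply_left W k i j]
  exact min_le_left _ _

/-- **Discharge of `shortestDist_le_of_le`**: `shortestDist W i j ≤ walkDistLE W k i j` for every
`k ≤ card ι`. [cite: CLRS2009, §25.1] -/
theorem shortestDist_le_of_le_holds : shortestDist_le_of_le (ι := ι) := by
  intro W k hk i j
  exact walkDistLE_antitone_holds W i j hk

/-! ### Unit weights: `walkDistLE (zeroOneWeights G) k` is the `≤ k`-edge graph distance -/

/-- Upper bound: for unit weights, `walkDistLE (zeroOneWeights G) k i j` is at most the length of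
any walk from `i` to `j` with at most `k` edges (induction on the walk, first-edge recurrence).
[cite: CLRS2009, §25.1 (`L⁽ᵐ⁾ᵢⱼ` = minimum weight of a path with at most `m` edges)] -/
theorem walkDistLE_zeroOneWeights_le_length (G : SimpleGraph ι) [DecidableRel G.Adj] {i j : ι}
    (p : G.Walk i j) {k : ℕ} (hk : p.length ≤ k) :
    walkDistLE (zeroOneWeights G) k i j ≤ (p.length : WithTop ℤ) := by
  induction p generalizing k with
  | nil =>
    calc walkDistLE (zeroOneWeights G) k _ _
        ≤ walkDistLE (zeroOneWeights G) 0 _ _ := walkDistLE_antitone_holds _ _ _ (Nat.zero_le k)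
      _ = 0 := by simp [walkDistLE_zero]
      _ ≤ _ := by simp
  | cons h q ih =>
    rename_i a b c
    obtain ⟨k, rfl⟩ : ∃ k', k = k' + 1 :=
      Nat.exists_eq_add_one_of_ne_zero (by rw [SimpleGraph.Walk.length_cons] at hk; omega)
    rw [SimpleGraph.Walk.length_cons] at hk
    have hq : q.length ≤ k := by omega
    rw [walkDistLE_succ_apply_left]
    calc min (walkDistLE (zeroOneWeights G) k a c)
          (Finset.univ.inf fun l => zeroOneWeights G a l + walkDistLE (zeroOneWeights G) k l c)
        ≤ zeroOneWeights G a b + walkDistLE (zeroOneWeights G) k b c :=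
          (min_le_right _ _).trans (Finset.inf_le (Finset.mem_univ b))
      _ ≤ 1 + (q.length : WithTop ℤ) := by
          rw [zeroOneWeights_apply, if_pos h]
          exact add_le_add le_rfl (ih hq)
      _ = ((SimpleGraph.Walk.cons h q).length : WithTop ℤ) := by
          rw [SimpleGraph.Walk.length_cons]; push_cast; exact add_comm _ _

/-- Attainment: for unit weights, `walkDistLE (zeroOneWeights G) k i j` is either `⊤` (no walk with
at most `k` edges) or the length of some walk from `i` to `j` with at most `k` edges (induction on
`k`, first-edge recurrence; the finite minimum is attained).
[cite: CLRS2009, §25.1 (`L⁽ᵐ⁾ᵢⱼ` = minimum weight of a path with at most `m` edges)] -/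
theorem walkDistLE_zeroOneWeights_eq_top_or_exists_walk (G : SimpleGraph ι) [DecidableRel G.Adj]
    (k : ℕ) (i j : ι) :
    walkDistLE (zeroOneWeights G) k i j = ⊤ ∨
      ∃ p : G.Walk i j, p.length ≤ k ∧
        walkDistLE (zeroOneWeights G) k i j = (p.length : WithTop ℤ) := by
  induction k generalizing i j with
  | zero =>
    rw [walkDistLE_zero, Matrix.of_apply]
    by_cases h : i = j
    · subst h
      exact Or.inr ⟨SimpleGraph.Walk.nil, le_rfl, by simp⟩
    · exact Or.inl (if_neg h)
  | succ k ih =>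
    rw [walkDistLE_succ_apply_left]
    rcases min_choice (walkDistLE (zeroOneWeights G) k i j)
        (Finset.univ.inf fun l => zeroOneWeights G i l + walkDistLE (zeroOneWeights G) k l j) with
      h | h
    · rw [h]
      rcases ih i j with h' | ⟨p, hp, h'⟩
      · exact Or.inl h'
      · exact Or.inr ⟨p, Nat.le_succ_of_le hp, h'⟩
    · rw [h]
      obtain ⟨l, -, hl⟩ := Finset.exists_mem_eq_inf Finset.univ ⟨i, Finset.mem_univ i⟩
        (fun l => zeroOneWeights G i l + walkDistLE (zeroOneWeights G) k l j)
      rw [hl, zeroOneWeights_apply]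
      by_cases hadj : G.Adj i l
      · rw [if_pos hadj]
        rcases ih l j with h' | ⟨p, hp, h'⟩
        · exact Or.inl (by rw [h', WithTop.add_top])
        · refine Or.inr ⟨SimpleGraph.Walk.cons hadj p, ?_, ?_⟩
          · rw [SimpleGraph.Walk.length_cons]; omega
          · rw [h', SimpleGraph.Walk.length_cons]; push_cast; exact add_comm _ _
      · rw [if_neg hadj]
        exact Or.inl (WithTop.top_add _)

/-! ### Discharges of the unit-weight bridge facts -/

/-- **Discharge of `shortestDist_zeroOneWeights`**: for unit weights the `≤ card ι`-edge walk
optimum is the graph distance, `shortestDist (zeroOneWeights G) i j = G.edist i j` (transported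
along `ℕ∞ → WithTop ℤ`): a shortest walk between reachable vertices may be taken to be a path, which
has fewer than `card ι` edges; unreachable pairs give `⊤` on both sides. This is the identification
of an unweighted graph with a `{1, ∞}`-weighted one (the case `M = 1` of the source's setting).
[cite: VassilevskaWilliamsWilliams2018, §1 Thm 1.1 p. 27:3 (weights {-M..M} ∪ {±∞}, M = 1)] -/
theorem shortestDist_zeroOneWeights_holds : shortestDist_zeroOneWeights (ι := ι) := by
  intro G _ i j
  unfold shortestDist
  by_cases hr : G.Reachable i j
  · obtain ⟨p₀, hp₀⟩ := hr.exists_walk_length_eq_edist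
    have hp : ((p₀.bypass.length : ℕ) : ℕ∞) = G.edist i j :=
      le_antisymm (hp₀ ▸ (by exact_mod_cast p₀.length_bypass_le_length))
        (SimpleGraph.edist_le _)
    have hlt : p₀.bypass.length < Fintype.card ι := p₀.bypass_isPath.length_lt
    rw [← hp, ENat.map_coe]
    apply le_antisymm
    · have := walkDistLE_zeroOneWeights_le_length G p₀.bypass hlt.le
      simpa using this
    · rcases walkDistLE_zeroOneWeights_eq_top_or_exists_walk G (Fintype.card ι) i j with
        h | ⟨q, -, hq⟩
      · rw [h]; exact le_top
      · rw [hq]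
        have hle : (p₀.bypass.length : ℕ∞) ≤ q.length := hp ▸ SimpleGraph.edist_le q
        have hle' : p₀.bypass.length ≤ q.length := by exact_mod_cast hle
        exact_mod_cast hle'
  · rw [SimpleGraph.edist_eq_top_of_not_reachable hr, ENat.map_top]
    rcases walkDistLE_zeroOneWeights_eq_top_or_exists_walk G (Fintype.card ι) i j with
      h | ⟨q, -, -⟩
    · exact h
    · exact absurd ⟨q⟩ hr

/-- **Discharge of `hasNoNegativeCycle_zeroOneWeights`**: unit weights have no negative cycle,
`shortestDist (zeroOneWeights G) i i = edist i i = 0` (all weights are nonnegative).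
[cite: CLRS2009, §24 (nonnegative weights admit no negative-weight cycle)] -/
theorem hasNoNegativeCycle_zeroOneWeights_holds : hasNoNegativeCycle_zeroOneWeights (ι := ι) := by
  intro G _ i
  rw [shortestDist_zeroOneWeights_holds G, SimpleGraph.edist_self]
  rfl

/-- **Discharge of `weightedEccentricity_zeroOneWeights`**: for unit weights the weighted
eccentricity `maxⱼ shortestDist (zeroOneWeights G) i j` is `SimpleGraph.eccent G i = ⨆ⱼ edist i j`
transported along `ℕ∞ → WithTop ℤ`: by `shortestDist_zeroOneWeights_holds` termwise, and the
finite supremum commutes with the monotone map `ENat.map Nat.cast`. (Radius/Diameter of an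
unweighted graph as the `M = 1` case of the weighted problems of the source, §1 Thm 1.1, and
Radius ≡₃ APSP, loc. cit. p. 27:3 after Abboud–Grandoni–Vassilevska Williams.)
[cite: VassilevskaWilliamsWilliams2018, §1 Thm 1.1 and p. 27:3 (Radius ≡₃ APSP); here M = 1] -/
theorem weightedEccentricity_zeroOneWeights_holds :
    weightedEccentricity_zeroOneWeights (ι := ι) := by
  intro _ G _ i
  unfold weightedEccentricity
  simp_rw [shortestDist_zeroOneWeights_holds G]
  rw [SimpleGraph.eccent, ← Finset.sup'_univ_eq_ciSup]
  exact (Finset.apply_sup'_eq_sup'_comp _ (ENat.map (Nat.cast : ℕ → ℤ)) fun x y =>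
    Monotone.map_sup (ENat.monotone_map_iff.2 Nat.mono_cast) x y).symm

end Literature.Computability.Cryptography
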